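import Summits.HodgeConjecture.HodgeConjecture.Theorems.R90S2ArchBlockPacketEndoscopyLetterDefs   -- ★ ℓT2-E v2 (K2E4-p23): `ArchBlockPacketEndoscopyLetter`
import Summits.HodgeConjecture.HodgeConjecture.Theorems.R90S2ArchBlockPacketLetterDefs     -- ★ p864938 ℓ1′: `BlockPacketData β`, `sgn ∕ bpos ∕ bneg`, (g1)(g3) glue
import Summits.HodgeConjecture.HodgeConjecture.Theorems.R90S2ArchBlockPairLetterDefs       -- ★ p864785 ℓ1+ℓ6: `ArchSmoothTensorLetterG`, `IsArchLocSmooth`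
import Summits.HodgeConjecture.HodgeConjecture.Theorems.R90S2TensorRepLetterDefs           -- ★ p864621 ℓ3: `ArchTensorRepLettersG`, `HasLocalComponents`, `archTensor_eq_piPure`
import Summits.HodgeConjecture.HodgeConjecture.Theorems.R90S2ArchTensorCuspPin            -- ★ p864437 CARD 5: `cuspG₀_archTensor_update` (+ ★ FILE 1, ★ CARD 2 `archTensor_update_sub`)
import Summits.HodgeConjecture.HodgeConjecture.Theorems.R90S2ArchHaarProduct              -- ★ p864547 CARD 6: `exists_pi_eq_map_archPiEquivCM`
import Summits.HodgeConjecture.HodgeConjecture.Theorems.R90S10ArchTransferSignsOfArchKit   -- ★ p863153 S10: the T1 consumer's frame; `hasArchOpTrace_of_areUnitarilyEquivalent`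
import Literature.NumberTheory.Automorphic.ArchLocalRegularOrbitClosed                     -- ★ `locallyCompactSpace_archLocal`, `secondCountableTopology_archLocal`
import HarnessLib

/-!
# R90-TF ∕ S2 «Ch. 12 archimedean block» — CARD 8 `R90S2ArchBlockPacketCuspOfLetters`: THE T2 ASSEMBLY — the block packet kit with cuspidal frozen pair FROM THE LETTERS

Cell `pub/hodgecm-mathlib`, HCML Track R90-TF, section S2 (base `R90-C11`); crux h413 = `stmt-HodgeConjecture-24833`, route of record `HCCMUnconditional`.
Hand: prover seat hodgecm-mathlib-K2E3-p25 (g5); dealer K2E1b-plan (g8) HEADS-CARD8 v1 (9bcb0da8d7fd23aa, 2026-09-05T02:30Z; deal 02:37:24Z (4)) + RULING R-S2-E1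
(03:01:08Z: full local packets `Fin 3`, audit E-1); auditor R90-C11-audit1 (g2) PRE-READ CLEAN 03:22:26Z.  THEOREMS ONLY (proof
lane): one public theorem + one private algebra lemma; NO def, NO socket, NO instance, NO notation, NO `sorry`, default heartbeats.

## WHAT IS PROVED

`archBlockPacketCusp_of_letters (S) (hℓ3) (hℓ6) (hE) : ‹TYPE of R90.S2.stub_R90_S2_archBlockPacketCusp, D ED. 2 :90–:126, VERBATIM›` — the S2 source socket T2 (and through
it T1 = S10's `hS2`) as a COMPOSITION of the three archimedean letters of the payment road (PAYMENT-ROADS-S2.v1 §1): ℓ3 ★ `ArchTensorRepLettersG` (LH7-p07), ℓ6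
★ `ArchSmoothTensorLetterG (S L)` (a theorem at the smoothness class of record `S := IsArchLocSmooth` by ★ §3′ `archSmooth_archTensor`), ℓT2-E v2
★ `ArchBlockPacketEndoscopyLetter L μ (S L)` (K2E4-p23; FULL local `L`-packets `BlockPacketData (Fin 3)`, RULING R-S2-E1).  The parameter `S` (the local test-function
class) is universally quantified over `L` like the letters; the Lines edition (D ED. 3) instantiates it and ties
`stub_R90_S2_archBlockPacketCusp := archBlockPacketCusp_of_letters _ hℓ3 hℓ6 hE` with the letters as its residual NAMED sockets.  Everything else is ★: CARD 2 (pure tensors,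
one-place surgery), CARD 5 (cusp pins of tensors), CARD 6 (Haar measures factor along ★ `archPiEquivCM`), CARD 7 (trace scaling, inside ★ ℓ1's glue), FILE 1 (the pins),
S10's kit frame.

HONEST LABEL: a composition of LETTERS — it pays NO printed input by itself; after the D ED. 3 tie the code-`sorry` T2 becomes the named letter hypotheses ℓ3, ℓT2-E (ℓ6
discharged at `IsArchLocSmooth`) — TYPED DEBT (Dixmier §13.1.8 ∕ Flath; Clozel–Delorme; Prop. 12.3.2 ∕ Shelstad), not payment.  HC_CM is proved only modulo the 7 printed
citations (2 remaining named inputs: hLiu418 = `stmt-HodgeConjecture-24832`, h413 = `stmt-HodgeConjecture-24833`) until rung 0 closes.  Count-neutral helper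
(`--supports stmt-HodgeConjecture-24833 --as helper`).

References: [Rogawski1990] §13.8 Prop. 13.8.3 (proof) p. 218 L15–28, §12.3 Prop. 12.3.2 p. 178, §14.3 pp. 233–234; [ClozelDelorme1984] Thm. 1; [Shelstad1979] L. 5.3;
[Arthur1988InvariantTraceFormulaII] §7 p. 538; [Dixmier1977] §13.1.8; [Flath1979] Thm. 1.
-/

set_option autoImplicit false
set_option linter.dupNamespace false

noncomputable section

open MeasureTheory MeasureTheory.Measure NumberField NumberField.InfinitePlace CompactlySupported
open scoped Matrix MatrixGroups InnerProductSpace Classical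
open Literature.NumberTheory.Automorphic Literature.NumberTheory.Automorphic.UnitaryGroup
open Literature.NumberTheory.Rogawski1990
open Literature.NumberTheory.GaloisRepresentations (HeckeCharacter)
open Summit.HodgeConjecture.HodgeConjecture.Cruxes.H413.K2E1bGKCohomologyU21.U8 (HasArchOpTrace)
open Summit.HodgeConjecture.HodgeConjecture.R90.S10 (GInf HInf phi3 archDeltaPP IsArchEndoCharId IsArchStablyNull hasArchOpTrace_of_areUnitarilyEquivalent)

namespace Summit.HodgeConjecture.HodgeConjecture.R90.S2

/-! ## §0 One algebra lemma (the dual-trace bookkeeping of step (c)) -/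

section Glue

/-- `∏_i [k i = k' i] = [k = k']` for functions on a finite index type (the dual-trace bookkeeping (c): a product of local `δ`'s is the global `δ`).
[cite: Rogawski1990, §13.8 p. 218 L20–28] -/
private theorem prod_boole_apply_eq {ι : Type*} [Fintype ι] {β : Type*} [DecidableEq β] (k k' : ι → β) [Decidable (k = k')] :
    (∏ i, if k i = k' i then (1 : ℂ) else 0) = if k = k' then 1 else 0 := by
  by_cases h : k = k'
  · subst h
    rw [if_pos rfl]
    exact Finset.prod_eq_one fun i _ => if_pos rfl
  · rw [if_neg h]
    obtain ⟨i, hi⟩ := Function.ne_iff.1 h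
    exact Finset.prod_eq_zero (Finset.mem_univ i) (if_neg hi)

end Glue

/-! ## §1 The assembly -/

section Assembly

/-- **CARD 8 — T2 FROM THE LETTERS**: the S2 source socket `R90.S2.stub_R90_S2_archBlockPacketCusp` (D ED. 2 :90–:126, its TYPE verbatim as the conclusion:
the archimedean BLOCK PACKET KIT with its cuspidal frozen pair and cuspidal `Δ″_∞`-transfer, §13.8 p. 218 L15–28 of the proof of Prop. 13.8.3) FOLLOWS from the
three letters ℓ3 (`ArchTensorRepLettersG`: external tensor products exist, exhaust, and are determined by their local components), ℓ6 (`ArchSmoothTensorLetterG (S L)`: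
pure tensors of `S`-class factors are `ArchSmooth` — a THEOREM at `S := IsArchLocSmooth` by ★ `archSmooth_archTensor`) and ℓT2-E v2 (`ArchBlockPacketEndoscopyLetter L μ (S L)`,
RULING R-S2-E1: FULL local `L`-packets `d w : BlockPacketData (Fin 3) …` at every place — print's `Π(ρ_v) = {π_{1v}, π_{2v}, π_{3v}}`, signs `⟨ρ_v, π_{jv}⟩`
not all equal — whose tensor families satisfy ★ `IsArchEndoCharId`, with stably null one-place differences admitting cuspidal smooth transfers).
PROOF (the dealer's 11 steps): local Borel structures + local Haar measures matching `ν` (★ CARD 6 `exists_pi_eq_map_archPiEquivCM` over Mathlib `Measure.haar`,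
★ `locallyCompactSpace_archLocal`); `d` from ℓT2-E; the packet `ϖ k`, `k : places → Fin 3`, CHOSEN from ℓ3-A on the local members `(d w).π (k w)` (instances carried by
`choose`); `f k := ⊗_w (d w).φ (k w)` (★ CARD 2); (b) ℓ6; (c) local dual traces multiply to the global `δ` (`HasLocalComponents` + `∏_w [k w = k′ w] = [k = k′]`, ★
`archTensor_eq_piPure`); (d) an irreducible unitary `π ≇` every `ϖ k` has, by ℓ3-B, local components one of which is neither member (else ℓ3-U gives `π ≅ ϖ b`), so its
trace on `f k` vanishes (★ `hasArchOpTrace_of_areUnitarilyEquivalent`, `hvan`, ★ `HasLocalComponents.hasArchOpTrace_zero_of_place`); (e) `s k := ∏_w (d w).sgn (k w)`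
with `k₁ := fun w => (d w).bpos`, `k₂ :=` `(d u₀).bneg` at one place `u₀` (a CM field has a complex place); (f) ℓT2-E (E1); (g) `f k₁ − f k₂ = ⊗ update φ⁺ u₀ (φ⁺_{u₀} −
φ⁻_{u₀})`,
`φ^± := φ bpos ∕ φ bneg` (★ CARD 2
`archTensor_update_sub`) is `CuspG₀` at every `ι` by ★ CARD 5 `cuspG₀_archTensor_update` with ★ ℓ1′ `BlockPacketData.isArchTraceCuspidal(_sub)`, stably null and cuspidally
transferred by ℓT2-E (E2)(E3).  The D ED. 3 tie is `exact archBlockPacketCusp_of_letters _ hℓ3 hℓ6 hE` (junction certified against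
`type_of% @stub_R90_S2_archBlockPacketCusp`).
[cite: Rogawski1990, §13.8 Prop. 13.8.3 (proof) p. 218 L15–28; §12.3 Prop. 12.3.2 p. 178; §14.3 pp. 233–234] [cite: ClozelDelorme1984, Thm. 1] [cite: Shelstad1979, L. 5.3]
[cite: Arthur1988InvariantTraceFormulaII, §7 p. 538] [cite: Dixmier1977, §13.1.8] [cite: Flath1979, Thm. 1] -/
theorem archBlockPacketCusp_of_letters
    (S : ∀ (L : Type) [Field L] [NumberField L] [IsCMField L] (w : {w : InfinitePlace L // w.IsComplex}), C_c(↥(archLocal L 3 (phi3 L) w), ℂ) → Prop)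
    (hℓ3 : ∀ (L : Type) [Field L] [NumberField L] [IsCMField L], ArchTensorRepLettersG L)
    (hℓ6 : ∀ (L : Type) [Field L] [NumberField L] [IsCMField L], ArchSmoothTensorLetterG L (S L))
    (hE : ∀ (L : Type) [Field L] [NumberField L] [IsCMField L] (μ : HeckeCharacter L), ArchBlockPacketEndoscopyLetter L μ (S L)) :
    ∀ (L : Type) [Field L] [NumberField L] [IsCMField L] (μ : HeckeCharacter L)
      [MeasurableSpace (GInf L)] [BorelSpace (GInf L)] (ν : Measure (GInf L)) [ν.IsHaarMeasure] [ν.IsMulRightInvariant]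
      [MeasurableSpace (HInf L)] [BorelSpace (HInf L)] (νH : Measure (HInf L)) [νH.IsHaarMeasure] [νH.IsMulRightInvariant],
    letI : ∀ a : HInf L, MeasurableSpace (HInf L ⧸ Subgroup.centralizer ({a} : Set (HInf L))) := fun _ => borel _
    haveI : ∀ a : HInf L, BorelSpace (HInf L ⧸ Subgroup.centralizer ({a} : Set (HInf L))) := fun _ => ⟨rfl⟩
    letI : ∀ γ : GInf L, MeasurableSpace (GInf L ⧸ Subgroup.centralizer ({γ} : Set (GInf L))) := fun _ => borel _
    haveI : ∀ γ : GInf L, BorelSpace (GInf L ⧸ Subgroup.centralizer ({γ} : Set (GInf L))) := fun _ => ⟨rfl⟩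
    ∀ (mH : OrbitalMeasureFamily (HInf L)) (mG : OrbitalMeasureFamily (GInf L))
      (tH : ∀ a : HInf L, Measure (Subgroup.centralizer ({a} : Set (HInf L))))
      (t : ∀ γ : GInf L, Measure (Subgroup.centralizer ({γ} : Set (GInf L)))),
      mG.IsQuotientOf (fun γ => IsRegularElt (γ.val : GL (Fin 3) (mixedEmbedding.mixedSpace L))) ν t →
      (∀ (γ₁ γ₂ : GInf L)
          (h₁ : IsRegularElt (γ₁.val : GL (Fin 3) (mixedEmbedding.mixedSpace L)))
          (hc : Corresponds (UnitaryGroup.conjMixed (↥(maximalRealSubfield L)) L (IsCMField.complexConj L))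
            (UnitaryGroup.archFormOf L 3 (phi3 L)) (UnitaryGroup.archFormOf L 3 (phi3 L)) γ₁ γ₂),
          Measure.map ⇑(UnitaryGroup.archStableCentralizerEquiv L (UnitaryGroup.isUnit_antidiagOne_det L 3).ne_zero
            (UnitaryGroup.isUnit_antidiagOne_det L 3).ne_zero hc h₁) (t γ₁) = t γ₂) →
      ArchCompatibleFamiliesH L νH mH tH t →
      IsArchNondegenerate L (phi3 L) (archDeltaPP L μ) →
      IsArchDeltaTransferExists L (phi3 L) (archDeltaPP L μ) mH mG (ArchSmooth L 3 (phi3 L)) (ArchSmooth₂ L) →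
        ∃ (κ : Type) (_ : Fintype κ) (_ : DecidableEq κ)
          (EG : κ → Type) (_ : ∀ k, NormedAddCommGroup (EG k)) (_ : ∀ k, InnerProductSpace ℂ (EG k)) (_ : ∀ k, CompleteSpace (EG k))
          (ϖ : ∀ k, ContRepresentation ℂ (GInf L) (EG k)) (hu : ∀ k, (ϖ k).IsUnitary) (hsc : ∀ k, (ϖ k).IsStronglyContinuous)
          (_ : ∀ k, (ϖ k).IsTopIrreducible)
          (f : κ → C_c(GInf L, ℂ)) (_ : ∀ k, ArchSmooth L 3 (phi3 L) ⇑(f k))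
          (_ : ∀ k k', HasArchOpTrace ν (ϖ k) (hu k) (hsc k) (f k') (if k = k' then 1 else 0))
          (_ : ∀ (E : Type) [NormedAddCommGroup E] [InnerProductSpace ℂ E] [CompleteSpace E]
              (π : ContRepresentation ℂ (GInf L) E) (hπu : π.IsUnitary) (hπsc : π.IsStronglyContinuous), π.IsTopIrreducible →
              (∀ k, ¬ ContRepresentation.AreUnitarilyEquivalent (ϖ k) π) → ∀ k, HasArchOpTrace ν π hπu hπsc (f k) 0)
          (s : κ → ℤ) (_ : ∀ k, s k = 1 ∨ s k = -1) (_ : ∃ k k', s k ≠ s k')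
          (EH : Type) (_ : NormedAddCommGroup EH) (_ : InnerProductSpace ℂ EH) (_ : CompleteSpace EH)
          (ρ : ContRepresentation ℂ (HInf L) EH) (huH : ρ.IsUnitary) (hscH : ρ.IsStronglyContinuous),
          IsArchEndoCharId L (archDeltaPP L μ) mH mG ν νH EG ϖ hu hsc s ρ huH hscH ∧
          ∃ k₁ k₂ : κ, s k₁ = 1 ∧ s k₂ = -1 ∧ (∀ ι : L →+* ℂ, CuspG₀ L mG ι ⇑(f k₁ - f k₂)) ∧ IsArchStablyNull L mG ⇑(f k₁ - f k₂) ∧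
            ∃ fH : C_c(HInf L, ℂ), ArchSmooth₂ L ⇑fH ∧ IsArchDeltaTransfer L (phi3 L) (archDeltaPP L μ) mH mG ⇑fH ⇑(f k₁ - f k₂) ∧
              ∀ ι : L →+* ℂ, CuspH₀ L mH ι ⇑fH := by
  intro L _ _ _ μ _ _ ν _ _ _ _ νH _ _ mH mG tH t hW hC hH hnd hex
  -- STEP 2: local Borel structures, local compactness ∕ second countability of the factors, and local Haar measures matching `ν`
  letI : ∀ w : {w : InfinitePlace L // w.IsComplex}, MeasurableSpace ↥(archLocal L 3 (phi3 L) w) := fun _ => borel _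
  haveI : ∀ w : {w : InfinitePlace L // w.IsComplex}, BorelSpace ↥(archLocal L 3 (phi3 L) w) := fun _ => ⟨rfl⟩
  haveI : ∀ w : {w : InfinitePlace L // w.IsComplex}, LocallyCompactSpace ↥(archLocal L 3 (phi3 L) w) :=
    fun w => locallyCompactSpace_archLocal L 3 (phi3 L) w
  haveI : ∀ w : {w : InfinitePlace L // w.IsComplex}, SecondCountableTopology ↥(archLocal L 3 (phi3 L) w) :=
    fun w => secondCountableTopology_archLocal L 3 (phi3 L) w
  obtain ⟨νw, hνwH, hνw⟩ := exists_pi_eq_map_archPiEquivCM L (phi3 L) ν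
    (fun w : {w : InfinitePlace L // w.IsComplex} => (Measure.haar : Measure ↥(archLocal L 3 (phi3 L) w)))
  haveI : ∀ w, (νw w).IsHaarMeasure := hνwH
  -- STEP 3: the endoscopy letter gives the block pairs `d w` at every place
  obtain ⟨d, hE1, hE23⟩ := hE L μ ν νH mH mG tH t hW hC hH hnd hex νw hνw
  letI instDN : ∀ (w : {w : InfinitePlace L // w.IsComplex}) (b : Fin 3), NormedAddCommGroup ((d w).E b) := fun w b => (d w).instNACG b
  letI instDI : ∀ (w : {w : InfinitePlace L // w.IsComplex}) (b : Fin 3), InnerProductSpace ℂ ((d w).E b) := fun w b => (d w).instIPS b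
  letI instDC : ∀ (w : {w : InfinitePlace L // w.IsComplex}) (b : Fin 3), CompleteSpace ((d w).E b) := fun w b => (d w).instCS b
  -- STEP 4: the tensor letters; the packet members `ϖ k`, `k : places → Fin 3`, as external tensor products of the local members
  obtain ⟨hA, hB, hU⟩ := hℓ3 L ν νw hνw
  have step4 : ∀ k : {w : InfinitePlace L // w.IsComplex} → Fin 3,
      ∃ (E : Type) (_ : NormedAddCommGroup E) (_ : InnerProductSpace ℂ E) (_ : CompleteSpace E)
        (σ : ContRepresentation ℂ (GInf L) E) (hu : σ.IsUnitary) (hsc : σ.IsStronglyContinuous),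
        σ.IsTopIrreducible ∧
          HasLocalComponents (archPiEquivCM L (phi3 L) (N := 3)) ν νw σ hu hsc
            (fun w => (d w).E (k w)) (fun w => (d w).π (k w)) (fun w => (d w).hu (k w)) (fun w => (d w).hsc (k w)) := fun k =>
    hA (fun w => (d w).E (k w)) (fun w => (d w).π (k w)) (fun w => (d w).hu (k w)) (fun w => (d w).hsc (k w)) fun w => (d w).hirr (k w)
  choose EG instN instI instC ϖ hu hsc hirr hloc using step4
  letI : ∀ k, NormedAddCommGroup (EG k) := instN
  letI : ∀ k, InnerProductSpace ℂ (EG k) := instI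
  letI : ∀ k, CompleteSpace (EG k) := instC
  -- STEP 5: the test functions `f k = ⊗_w φ_{k w}`
  obtain ⟨f, hf⟩ : ∃ f : ({w : InfinitePlace L // w.IsComplex} → Fin 3) → C_c(GInf L, ℂ),
      ∀ k, f k = archTensor L (phi3 L) (fun w => (d w).φ (k w)) := ⟨_, fun _ => rfl⟩
  -- STEP 7: (d) vanishing off the packet
  have hd : ∀ (E : Type) [NormedAddCommGroup E] [InnerProductSpace ℂ E] [CompleteSpace E]
      (π : ContRepresentation ℂ (GInf L) E) (hπu : π.IsUnitary) (hπsc : π.IsStronglyContinuous), π.IsTopIrreducible →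
      (∀ k, ¬ ContRepresentation.AreUnitarilyEquivalent (ϖ k) π) → ∀ k, HasArchOpTrace ν π hπu hπsc (f k) 0 := by
    intro E _ _ _ π hπu hπsc hπirr hπne k
    obtain ⟨Eι', iN, iI, iC, π', huι', hscι', hirr', hloc'⟩ := hB E π hπu hπsc hπirr
    by_cases hall : ∀ w, ∃ b : Fin 3, ContRepresentation.AreUnitarilyEquivalent ((d w).π b) (π' w)
    · -- every local component is a member: `π ≅ ϖ b` by ℓ3-U, contradicting `hπne`
      choose b hb using hall
      exact absurd (hU (EG b) E (ϖ b) (hu b) (hsc b) π hπu hπsc (fun w => (d w).E (b w)) Eι' (fun w => (d w).π (b w))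
        (fun w => (d w).hu (b w)) (fun w => (d w).hsc (b w)) π' huι' hscι' (hirr b) hπirr (fun w => (d w).hirr (b w)) hirr' (hloc b) hloc' hb)
        (hπne b)
    · -- one local component `π'_{w₀}` is neither member: the local trace of `φ_{k w₀}` on it is `0`, hence the global trace is `0`
      push Not at hall
      obtain ⟨w₀, hw₀⟩ := hall
      have ht : ∀ w, ∃ tw : ℂ, HasArchOpTrace (νw w) (π' w) (huι' w) (hscι' w) ((d w).φ (k w)) tw ∧ (w = w₀ → tw = 0) := by
        intro w
        by_cases hw : ∃ b : Fin 3, ContRepresentation.AreUnitarilyEquivalent ((d w).π b) (π' w)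
        · obtain ⟨b, hb⟩ := hw
          refine ⟨if b = k w then 1 else 0, hasArchOpTrace_of_areUnitarilyEquivalent hb ((d w).htr b (k w)), fun hww => ?_⟩
          subst hww
          exact absurd hb (hw₀ b)
        · push Not at hw
          exact ⟨0, (d w).hvan _ (π' w) (huι' w) (hscι' w) (hirr' w) hw (k w), fun _ => rfl⟩
      choose tw htw htw0 using ht
      have h0 := hloc'.hasArchOpTrace_zero_of_place (fun w => (d w).φ (k w)) tw htw w₀ (htw0 w₀ rfl)
      rwa [← archTensor_eq_piPure, ← hf] at h0
  -- STEP 8: signs; the two members `k₁ = (+,…,+)` and `k₂` (one `−` at `u₀`)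
  obtain ⟨u₀⟩ : Nonempty {w : InfinitePlace L // w.IsComplex} := ⟨⟨Classical.arbitrary _, IsTotallyComplex.isComplex _⟩⟩
  obtain ⟨k₁, hk₁⟩ : ∃ k₁ : {w : InfinitePlace L // w.IsComplex} → Fin 3, k₁ = fun w => (d w).bpos := ⟨_, rfl⟩
  obtain ⟨k₂, hk₂⟩ : ∃ k₂ : {w : InfinitePlace L // w.IsComplex} → Fin 3, k₂ = Function.update k₁ u₀ (d u₀).bneg := ⟨_, rfl⟩
  have hk₁w : ∀ w, k₁ w = (d w).bpos := fun w => by rw [hk₁]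
  have hk₂u : k₂ u₀ = (d u₀).bneg := by rw [hk₂, Function.update_self]
  have hk₂w : ∀ w, w ≠ u₀ → k₂ w = (d w).bpos := fun w hw => by rw [hk₂, Function.update_of_ne hw, hk₁]
  have hsk : ∀ k : {w : InfinitePlace L // w.IsComplex} → Fin 3, (∏ w, (d w).sgn (k w)) = 1 ∨ (∏ w, (d w).sgn (k w)) = -1 := fun k => by
    refine Finset.prod_induction (fun w => (d w).sgn (k w)) (fun x : ℤ => x = 1 ∨ x = -1) ?_ (Or.inl rfl) fun w _ => (d w).hsgn (k w)
    rintro a b (rfl | rfl) (rfl | rfl) <;> simp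
  have hsk₁ : (∏ w, (d w).sgn (k₁ w)) = 1 := Finset.prod_eq_one fun w _ => by rw [hk₁w, (d w).sgn_bpos]
  have hsk₂ : (∏ w, (d w).sgn (k₂ w)) = -1 := by
    rw [Fintype.prod_eq_mul_prod_compl u₀, hk₂u, (d u₀).sgn_bneg]
    have h1 : ∏ w ∈ ({u₀}ᶜ : Finset {w : InfinitePlace L // w.IsComplex}), (d w).sgn (k₂ w) = 1 :=
      Finset.prod_eq_one fun w hw => by
        rw [Finset.mem_compl, Finset.mem_singleton] at hw
        rw [hk₂w w hw, (d w).sgn_bpos]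
    rw [h1, mul_one]
  -- STEP 9: (f) the endoscopic character identity for the family `ϖ` (ℓT2-E (E1))
  obtain ⟨EH, iH1, iH2, iH3, ρ, huH, hscH, hid⟩ := hE1 EG ϖ hu hsc hloc
  -- STEP 10: (g) the frozen difference `f k₁ − f k₂` IS the one-place difference tensor at `u₀` (★ CARD 2 `archTensor_update_sub`)
  obtain ⟨hSN, fH, hfH, htrH, hcuspH⟩ := hE23 u₀
  have hk₁φ : (fun w => (d w).φ (k₁ w)) = Function.update (fun w => (d w).φ (d w).bpos) u₀ ((d u₀).φ (d u₀).bpos) := by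
    funext w
    by_cases hw : w = u₀
    · subst hw
      rw [Function.update_self, hk₁w]
    · rw [Function.update_of_ne hw, hk₁w]
  have hk₂φ : (fun w => (d w).φ (k₂ w)) = Function.update (fun w => (d w).φ (d w).bpos) u₀ ((d u₀).φ (d u₀).bneg) := by
    funext w
    by_cases hw : w = u₀
    · subst hw
      rw [Function.update_self, hk₂u]
    · rw [Function.update_of_ne hw, hk₂w w hw]
  have hdiff : f k₁ - f k₂ =
      archTensor L (phi3 L) (Function.update (fun w => (d w).φ (d w).bpos) u₀ ((d u₀).φ (d u₀).bpos - (d u₀).φ (d u₀).bneg)) := by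
    rw [hf k₁, hf k₂, hk₁φ, hk₂φ, archTensor_update_sub]
  -- transport of any clause about the one-place difference tensor to `f k₁ - f k₂` (one small rewrite per clause)
  have hcast : ∀ (P : C_c(GInf L, ℂ) → Prop),
      P (archTensor L (phi3 L) (Function.update (fun w => (d w).φ (d w).bpos) u₀ ((d u₀).φ (d u₀).bpos - (d u₀).φ (d u₀).bneg))) →
        P (f k₁ - f k₂) := fun P h => by
    rw [hdiff]
    exact h
  -- STEP 11: assemble the 30-field witness
  refine ⟨({w : InfinitePlace L // w.IsComplex} → Fin 3), inferInstance, inferInstance, EG, instN, instI, instC, ϖ, hu, hsc, hirr, f,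
    ?_, ?_, hd, fun k => ∏ w, (d w).sgn (k w), hsk, ⟨k₁, k₂, ?_⟩,
    EH, iH1, iH2, iH3, ρ, huH, hscH, hid, k₁, k₂, hsk₁, hsk₂, ?_, ?_, fH, hfH, ?_, hcuspH⟩
  · -- (b) the pure tensors are smooth (ℓ6)
    intro k
    rw [hf]
    exact hℓ6 L _ fun w => (d w).hS (k w)
  · -- (c) dual traces: local `δ`'s multiply to the global `δ` (ℓ3-A through `HasLocalComponents`)
    intro k k'
    have e1 : f k' = piPure (archPiEquivCM L (phi3 L) (N := 3)).toHomeomorph (fun w => (d w).φ (k' w)) := by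
      rw [hf, archTensor_eq_piPure]
    have e2 : (if k = k' then (1 : ℂ) else 0) = ∏ w, if k w = k' w then (1 : ℂ) else 0 := (prod_boole_apply_eq k k').symm
    rw [e1, e2]
    exact (hloc k).1 (fun w => (d w).φ (k' w)) (fun w => if k w = k' w then 1 else 0) fun w => (d w).htr (k w) (k' w)
  · -- (e) two different signs
    show (∏ w, (d w).sgn (k₁ w)) ≠ ∏ w, (d w).sgn (k₂ w)
    rw [hsk₁, hsk₂]
    decide
  · -- (g) the frozen difference is `CuspG₀` at every `ι` (★ CARD 5 + the block pairs' trace-cuspidality)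
    intro ι
    exact hcast (fun g => CuspG₀ L mG ι ⇑g)
      (cuspG₀_archTensor_update L mG (fun w => (d w).φ (d w).bpos) u₀ ((d u₀).φ (d u₀).bpos - (d u₀).φ (d u₀).bneg)
        ((d u₀).isArchTraceCuspidal_sub (d u₀).bpos (d u₀).bneg) (fun w _ => (d w).isArchTraceCuspidal (d w).bpos) ι)
  · -- (g) stable nullity (ℓT2-E (E2))
    exact hcast (fun g => IsArchStablyNull L mG ⇑g) hSN
  · -- (g) the smooth cuspidal transfer (ℓT2-E (E3)); ★ `IsArchDeltaTransfer` is an `abbrev`, so rewrite ONLY its last argument (no motive over the unfolded body)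
    conv => arg 7; rw [hdiff]
    exact htrH

end Assembly

end Summit.HodgeConjecture.HodgeConjecture.R90.S2

end
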